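import Summits.Ventures.YMGap.Thresholds.OneLinkOmega
import Summits.Ventures.YMGap.Thresholds.OneLinkOmegaGradient
import Summits.Ventures.YMGap.Thresholds.OneLinkLevelTwoSD
import HarnessLib

/-!
# Venture YMGap — the one-link modulus beyond first order, part 30: the CLOSED-FORM quadratic-mean bound `ω⁺(N, r)` and the
# `L²(ν_B)` gradient norm of `u + ψ₂` through `√((1+ω⁺)/2)`

HONEST FRAMING: venture file of the cell `pub-ymgap` (QuantumFields programme), strong-coupling LATTICE bookkeeping for `SU(N)`
lattice Yang–Mills; nothing about the continuum or the mass gap in the Clay sense.  No number of record moves here (this is the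
A-part input of the `ω`-refined level-two modulus, cell note `HOME/p2/ONE-LINK-HIERARCHY.md` §13 option (1)).

WHAT.  `ν_B(dg) ∝ exp(N Re tr(gB)) dg` on `SU(N)`, `r = ‖B‖_op`, `Z_M = √(E_ν|tr(gM)|²)`, `a = 2N − 4/N`, `c₁ = Na/(a²−4)`,
`c₂ = 2N/(a²−4)`, `s = √(r²/4 + 1/N²)`, `ω̂ = r²/2 + r·s`.
* `sqrt_meanSq_le_sqrt_integral_normSq`: `√((E Re tr(gM))² + (E Im tr(gM))²) ≤ Z_M` (Jensen);
* `half_add_sqrt_le`: `‖B‖_F/2 + √(‖B‖_F²/4 + 1/N) ≤ √N (r/2 + s)` for `‖B‖_F ≤ √N r`;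
* `abs_integral_reTrQuad_DD_le_omegaPlus` (`N ≥ 3`): `|E Re tr(gΔgΔ)| ≤ ω⁺(N, r) ‖Δ‖_F²` with
  `ω⁺(N, r) = 2c₁(r + ω̂) + 2c₂N(ω̂ + r(r/2 + s)²)` — `OneLinkOmega.abs_integral_reTrQuad_DD_le` with every second moment taken
  from the Schwinger–Dyson variance (`OneLinkSDVariance`, `OneLinkLevelTwoSD.levelTwoS_scale`): `Z₁ ≤ Nω̂`, `‖B‖_F Z₂ ≤ ‖Δ‖_F Nω̂`,
  `A_Δ ≤ Z₂`, `Z₂ ≤ ‖Δ‖_F √N (r/2 + s)`;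
* `sqrt_integral_Gam_upsi_le_omegaPlus` (`N ≥ 3`): `√∫Γ(u+ψ₂,u+ψ₂) dν_B ≤ ‖Δ‖_F √((1+ω⁺(N,r))/2) + 2κ_w r‖Δ‖_F + κ₁(‖Δ‖_F Z₁ + ‖B‖_F Z₂)`
  (`OneLinkOmegaGradient.sqrt_integral_Gam_upsi_le_omega` fed with the bound above) — the A-part of the level-two modulus with
  `1 ↦ √((1+ω⁺)/2)` (`ω⁺(10, 0.24) = 0.405`, `√((1+ω⁺)/2) = 0.838`).

References: cell note `HOME/p2/ONE-LINK-HIERARCHY.md` §4 (4.4)–(4.5), §13 (1); Shen–Zhu–Zhu CMP 400 (2023) §4.1.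
-/

noncomputable section

open scoped Matrix ComplexConjugate BigOperators ContDiff Matrix.Norms.Frobenius
open Matrix Complex Finset MeasureTheory ProbabilityTheory
open Literature.MathematicalPhysics.QuantumFieldTheory
open Literature.MathematicalPhysics.QuantumFieldTheory.SUNBakryEmery

namespace Summit.Ventures.YMGap.OneLinkEigen

variable {N : ℕ}

/-! ### Two small inputs: the mean is below the second moment, and the second-moment scale at `‖B‖_F ≤ √N r` -/

/-- **Jensen for the complex linear statistic**: `√((E Re tr(gM))² + (E Im tr(gM))²) ≤ √(E |tr(gM)|²)` under `ν_B`. [folklore] -/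
theorem sqrt_meanSq_le_sqrt_integral_normSq (B M : Matrix (Fin N) (Fin N) ℂ) :
    Real.sqrt ((∫ g, ((g : Matrix (Fin N) (Fin N) ℂ) * M).trace.re
          ∂(haarProbability (SUN N)).tilted (fun g => (N : ℝ) * ((g : Matrix (Fin N) (Fin N) ℂ) * B).trace.re)) ^ 2
        + (∫ g, ((g : Matrix (Fin N) (Fin N) ℂ) * M).trace.im
          ∂(haarProbability (SUN N)).tilted (fun g => (N : ℝ) * ((g : Matrix (Fin N) (Fin N) ℂ) * B).trace.re)) ^ 2) ≤
      Real.sqrt (∫ g, ‖((g : Matrix (Fin N) (Fin N) ℂ) * M).trace‖ ^ 2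
        ∂(haarProbability (SUN N)).tilted (fun g => (N : ℝ) * ((g : Matrix (Fin N) (Fin N) ℂ) * B).trace.re)) := by
  set ν : Measure (SUN N) :=
    (haarProbability (SUN N)).tilted (fun g => (N : ℝ) * ((g : Matrix (Fin N) (Fin N) ℂ) * B).trace.re) with hν
  have hexpi : Integrable (fun g : SUN N => Real.exp ((N : ℝ) * ((g : Matrix (Fin N) (Fin N) ℂ) * B).trace.re))
      (haarProbability (SUN N)) :=
    integrable_of_continuous_SUN (Real.continuous_exp.comp (continuous_restrict (contDiff_pot (N : ℝ) B))) _
  haveI : IsProbabilityMeasure ν := isProbabilityMeasure_tilted hexpi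
  set fr : SUN N → ℝ := fun g => ((g : Matrix (Fin N) (Fin N) ℂ) * M).trace.re with hfr
  set fi : SUN N → ℝ := fun g => ((g : Matrix (Fin N) (Fin N) ℂ) * M).trace.im with hfi
  have hfrc : Continuous fr := continuous_re_trace_su_mul M
  have hfic : Continuous fi := (continuous_restrict (N := N) (contDiff_pot 1 ((-I) • M))).congr
    (fun g => by simp only [pot, one_mul, re_trace_mul_negI_smul, hfi])
  have mr : MemLp fr 2 ν := memLp_two_of_continuous hfrc ν
  have mi : MemLp fi 2 ν := memLp_two_of_continuous hfic ν
  have hsq : (fun g : SUN N => ‖((g : Matrix (Fin N) (Fin N) ℂ) * M).trace‖ ^ 2) = fun g => fr g ^ 2 + fi g ^ 2 := by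
    funext g; rw [Complex.sq_norm, Complex.normSq_apply]; simp only [hfr, hfi]; ring
  have i1 : Integrable (fun g => fr g ^ 2) ν := integrable_of_continuous_SUN (hfrc.pow 2) ν
  have i2 : Integrable (fun g => fi g ^ 2) ν := integrable_of_continuous_SUN (hfic.pow 2) ν
  have hvr : ∫ g, fr g ^ 2 ∂ν = Var[fr; ν] + (∫ g, fr g ∂ν) ^ 2 := by
    rw [variance_eq_sub mr]; simp
  have hvi : ∫ g, fi g ^ 2 ∂ν = Var[fi; ν] + (∫ g, fi g ∂ν) ^ 2 := by
    rw [variance_eq_sub mi]; simp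
  refine Real.sqrt_le_sqrt ?_
  rw [hsq, integral_add i1 i2, hvr, hvi]
  linarith only [variance_nonneg fr ν, variance_nonneg fi ν]

/-- **The second-moment scale per unit of `‖M‖_F` at `‖B‖_F ≤ √N r`**: `‖B‖_F/2 + √(‖B‖_F²/4 + 1/N) ≤ √N (r/2 + √(r²/4 + 1/N²))`.
[folklore] -/
theorem half_add_sqrt_le (hN : (0 : ℝ) < N) {nB r : ℝ} (hnB0 : 0 ≤ nB) (hnB : nB ≤ Real.sqrt N * r) (hr0 : 0 ≤ r) :
    nB / 2 + Real.sqrt (nB ^ 2 / 4 + 1 / N) ≤ Real.sqrt N * (r / 2 + Real.sqrt (r ^ 2 / 4 + 1 / (N : ℝ) ^ 2)) := by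
  have hS0 : 0 ≤ Real.sqrt N := Real.sqrt_nonneg _
  have hS2 : Real.sqrt N * Real.sqrt N = N := Real.mul_self_sqrt hN.le
  have hSr0 : 0 ≤ Real.sqrt N * r := mul_nonneg hS0 hr0
  have hsq : nB * nB ≤ (Real.sqrt N * r) * (Real.sqrt N * r) := mul_le_mul hnB hnB hnB0 hSr0
  have e1 : (Real.sqrt N * r) ^ 2 / 4 + 1 / N = (N : ℝ) * (r ^ 2 / 4 + 1 / (N : ℝ) ^ 2) := by
    rw [mul_pow, Real.sq_sqrt hN.le]
    field_simp
  have a2 : Real.sqrt (nB ^ 2 / 4 + 1 / N) ≤ Real.sqrt ((Real.sqrt N * r) ^ 2 / 4 + 1 / N) :=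
    Real.sqrt_le_sqrt (by nlinarith only [hsq])
  rw [e1, Real.sqrt_mul hN.le] at a2
  have a1 : nB / 2 ≤ Real.sqrt N * (r / 2) := by linarith only [hnB]
  calc nB / 2 + Real.sqrt (nB ^ 2 / 4 + 1 / N)
      ≤ Real.sqrt N * (r / 2) + Real.sqrt N * Real.sqrt (r ^ 2 / 4 + 1 / (N : ℝ) ^ 2) := add_le_add a1 a2
    _ = _ := by ring

/-! ### The closed-form quadratic-mean bound `ω⁺(N, r)` -/

/-- **`|E_ν Re tr(gΔgΔ)| ≤ ω⁺(N, ‖B‖_op) · ‖Δ‖_F²`, `N ≥ 3`**, with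
`ω⁺(N,r) = 2c₁(r + ω̂) + 2c₂N(ω̂ + r(r/2+s)²)`, `a = 2N − 4/N`, `c₁ = Na/(a²−4)`, `c₂ = 2N/(a²−4)`, `s = √(r²/4+1/N²)`,
`ω̂ = r²/2 + r s` — the primitive `ω` of the cell note in closed form (every second moment by Schwinger–Dyson). [folklore] -/
theorem abs_integral_reTrQuad_DD_le_omegaPlus (hN : 3 ≤ N) (B Δ : Matrix (Fin N) (Fin N) ℂ) :
    |∫ g, ((g : Matrix (Fin N) (Fin N) ℂ) * Δ * g * Δ).trace.re
        ∂(haarProbability (SUN N)).tilted (fun g => (N : ℝ) * ((g : Matrix (Fin N) (Fin N) ℂ) * B).trace.re)| ≤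
      (2 * ((N : ℝ) * (2 * (N : ℝ) - 4 / N) / ((2 * (N : ℝ) - 4 / N) ^ 2 - 4)) *
            (matrixOpNorm B + (matrixOpNorm B ^ 2 / 2 + matrixOpNorm B * Real.sqrt (matrixOpNorm B ^ 2 / 4 + 1 / (N : ℝ) ^ 2)))
          + 2 * (2 * (N : ℝ) / ((2 * (N : ℝ) - 4 / N) ^ 2 - 4)) * N *
            ((matrixOpNorm B ^ 2 / 2 + matrixOpNorm B * Real.sqrt (matrixOpNorm B ^ 2 / 4 + 1 / (N : ℝ) ^ 2))
              + matrixOpNorm B * (matrixOpNorm B / 2 + Real.sqrt (matrixOpNorm B ^ 2 / 4 + 1 / (N : ℝ) ^ 2)) ^ 2)) *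
        frobNorm Δ ^ 2 := by
  have hN0 : N ≠ 0 := by omega
  have h3 : (3 : ℝ) ≤ N := by exact_mod_cast hN
  have hNpos : (0 : ℝ) < N := by linarith
  set ν : Measure (SUN N) :=
    (haarProbability (SUN N)).tilted (fun g => (N : ℝ) * ((g : Matrix (Fin N) (Fin N) ℂ) * B).trace.re) with hν
  set r : ℝ := matrixOpNorm B with hr
  set nB : ℝ := frobNorm B with hnB
  set nD : ℝ := frobNorm Δ with hnD
  set s : ℝ := Real.sqrt (r ^ 2 / 4 + 1 / (N : ℝ) ^ 2) with hs
  set om : ℝ := r ^ 2 / 2 + r * s with hom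
  set a : ℝ := 2 * (N : ℝ) - 4 / N with ha
  set Z₁ : ℝ := Real.sqrt (∫ g, ‖((g : Matrix (Fin N) (Fin N) ℂ) * B).trace‖ ^ 2 ∂ν) with hZ₁
  set Z₂ : ℝ := Real.sqrt (∫ g, ‖((g : Matrix (Fin N) (Fin N) ℂ) * Δ).trace‖ ^ 2 ∂ν) with hZ₂
  set A : ℝ := Real.sqrt ((∫ g, ((g : Matrix (Fin N) (Fin N) ℂ) * Δ).trace.re ∂ν) ^ 2
      + (∫ g, ((g : Matrix (Fin N) (Fin N) ℂ) * Δ).trace.im ∂ν) ^ 2) with hA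
  have hr0 : 0 ≤ r := matrixOpNorm_nonneg B
  have hnB0 : 0 ≤ nB := frobNorm_nonneg B
  have hnD0 : 0 ≤ nD := frobNorm_nonneg Δ
  have hs0 : 0 ≤ s := Real.sqrt_nonneg _
  have hom0 : 0 ≤ om := by rw [hom]; positivity
  have hZ10 : 0 ≤ Z₁ := Real.sqrt_nonneg _
  have hZ20 : 0 ≤ Z₂ := Real.sqrt_nonneg _
  have ha4 : 4 < a := by
    have : (4 : ℝ) / N ≤ 4 / 3 := by rw [div_le_div_iff₀ hNpos (by norm_num)]; linarith
    rw [ha]; linarith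
  have hden : 0 < a ^ 2 - 4 := by nlinarith
  have hc1 : 0 ≤ (N : ℝ) * a / (a ^ 2 - 4) := div_nonneg (mul_nonneg hNpos.le (by linarith)) hden.le
  have hc2 : 0 ≤ 2 * (N : ℝ) / (a ^ 2 - 4) := div_nonneg (by positivity) hden.le
  have hnBr : nB ≤ Real.sqrt N * r := frobNorm_le_sqrt_mul_matrixOpNorm B
  -- the four second-moment inputs
  have hscale := levelTwoS_scale hNpos hnB0 hnBr hr0
  have F1 : Z₁ ≤ (N : ℝ) * om := (sqrt_integral_normSq_trace_le_sd hN0 B B).trans hscale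
  have hZ2M : Z₂ ≤ nD * (nB / 2 + Real.sqrt (nB ^ 2 / 4 + 1 / N)) := sqrt_integral_normSq_trace_le_sd hN0 B Δ
  have F2 : nB * Z₂ ≤ nD * ((N : ℝ) * om) := by
    calc nB * Z₂ ≤ nB * (nD * (nB / 2 + Real.sqrt (nB ^ 2 / 4 + 1 / N))) := mul_le_mul_of_nonneg_left hZ2M hnB0
      _ = nD * (nB * (nB / 2 + Real.sqrt (nB ^ 2 / 4 + 1 / N))) := by ring
      _ ≤ nD * ((N : ℝ) * om) := mul_le_mul_of_nonneg_left hscale hnD0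
  have F3 : A ≤ Z₂ := sqrt_meanSq_le_sqrt_integral_normSq B Δ
  have F4 : Z₂ ≤ nD * (Real.sqrt N * (r / 2 + s)) :=
    hZ2M.trans (mul_le_mul_of_nonneg_left (half_add_sqrt_le hNpos hnB0 hnBr hr0) hnD0)
  have hSq0 : 0 ≤ Real.sqrt N * (r / 2 + s) := by positivity
  have F4sq : Z₂ ^ 2 ≤ nD ^ 2 * ((N : ℝ) * (r / 2 + s) ^ 2) := by
    calc Z₂ ^ 2 ≤ (nD * (Real.sqrt N * (r / 2 + s))) ^ 2 := pow_le_pow_left₀ hZ20 F4 2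
      _ = nD ^ 2 * ((Real.sqrt N) ^ 2 * (r / 2 + s) ^ 2) := by ring
      _ = nD ^ 2 * ((N : ℝ) * (r / 2 + s) ^ 2) := by rw [Real.sq_sqrt hNpos.le]
  -- the tree bound with symbolic second moments
  have h := abs_integral_reTrQuad_DD_le hN B Δ
  rw [← hν, ← hr, ← hnB, ← hnD, ← ha, ← hZ₁, ← hZ₂, ← hA] at h
  -- first bracket
  have b1 : 2 * r * nD ^ 2 + 2 / N * nD ^ 2 * Z₁ ≤ nD ^ 2 * (2 * (r + om)) := by
    have t : 2 / N * nD ^ 2 * Z₁ ≤ 2 / N * nD ^ 2 * ((N : ℝ) * om) := mul_le_mul_of_nonneg_left F1 (by positivity)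
    have e : 2 / N * nD ^ 2 * ((N : ℝ) * om) = 2 * nD ^ 2 * om := by field_simp
    linarith only [t, e]
  -- second bracket
  have b2 : nB * nD * Z₂ + nB * nD * A + 2 * r * Z₂ ^ 2 ≤ nD ^ 2 * (2 * N * (om + r * (r / 2 + s) ^ 2)) := by
    have t1 : nB * nD * Z₂ ≤ nD * (nD * ((N : ℝ) * om)) := by
      calc nB * nD * Z₂ = nD * (nB * Z₂) := by ring
        _ ≤ nD * (nD * ((N : ℝ) * om)) := mul_le_mul_of_nonneg_left F2 hnD0
    have t2 : nB * nD * A ≤ nD * (nD * ((N : ℝ) * om)) := by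
      calc nB * nD * A ≤ nB * nD * Z₂ := mul_le_mul_of_nonneg_left F3 (mul_nonneg hnB0 hnD0)
        _ ≤ _ := t1
    have t3 : 2 * r * Z₂ ^ 2 ≤ 2 * r * (nD ^ 2 * ((N : ℝ) * (r / 2 + s) ^ 2)) := mul_le_mul_of_nonneg_left F4sq (by positivity)
    have e : nD * (nD * ((N : ℝ) * om)) + nD * (nD * ((N : ℝ) * om)) + 2 * r * (nD ^ 2 * ((N : ℝ) * (r / 2 + s) ^ 2)) =
        nD ^ 2 * (2 * N * (om + r * (r / 2 + s) ^ 2)) := by ring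
    linarith only [t1, t2, t3, e]
  have hb1 := mul_le_mul_of_nonneg_left b1 hc1
  have hb2 := mul_le_mul_of_nonneg_left b2 hc2
  refine h.trans ?_
  have e : (N : ℝ) * a / (a ^ 2 - 4) * (nD ^ 2 * (2 * (r + om))) + 2 * (N : ℝ) / (a ^ 2 - 4) * (nD ^ 2 * (2 * N * (om + r * (r / 2 + s) ^ 2))) =
      (2 * ((N : ℝ) * a / (a ^ 2 - 4)) * (r + om) + 2 * (2 * (N : ℝ) / (a ^ 2 - 4)) * N * (om + r * (r / 2 + s) ^ 2)) * nD ^ 2 := by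
    ring
  linarith only [hb1, hb2, e]

/-! ### The A-part through `√((1 + ω⁺)/2)` -/

/-- **`√∫Γ(u+ψ₂,u+ψ₂) dν_B ≤ ‖Δ‖_F √((1+ω⁺(N,‖B‖_op))/2) + 2κ_w‖B‖_op‖Δ‖_F + κ₁(‖Δ‖_F Z₁ + ‖B‖_F Z₂)`, `N ≥ 3`** — the A-part of the
level-two modulus with `1 ↦ √((1+ω⁺)/2)` (`OneLinkOmegaGradient.sqrt_integral_Gam_upsi_le_omega` with the closed-form `ω⁺`).
[folklore] -/
theorem sqrt_integral_Gam_upsi_le_omegaPlus (hN : 3 ≤ N) (B Δ : Matrix (Fin N) (Fin N) ℂ) :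
    Real.sqrt (∫ g, Gam (pot 1 Δ + fun Q : Matrix (Fin N) (Fin N) ℂ =>
          -((N : ℝ) ^ 2 / (4 * ((N : ℝ) ^ 2 - 4))) * (Q * Δ * Q * B).trace.re
            + ((N : ℝ) / (2 * ((N : ℝ) ^ 2 - 4))) * ((Q * B).trace * (Q * Δ).trace).re
            - (1 / (4 * (N : ℝ))) * ((Q * B).trace * (starRingEnd ℂ) (Q * Δ).trace).re)
        (pot 1 Δ + fun Q : Matrix (Fin N) (Fin N) ℂ =>
          -((N : ℝ) ^ 2 / (4 * ((N : ℝ) ^ 2 - 4))) * (Q * Δ * Q * B).trace.re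
            + ((N : ℝ) / (2 * ((N : ℝ) ^ 2 - 4))) * ((Q * B).trace * (Q * Δ).trace).re
            - (1 / (4 * (N : ℝ))) * ((Q * B).trace * (starRingEnd ℂ) (Q * Δ).trace).re) g
        ∂(haarProbability (SUN N)).tilted (fun g => (N : ℝ) * ((g : Matrix (Fin N) (Fin N) ℂ) * B).trace.re)) ≤
      (frobNorm Δ * Real.sqrt ((1 +
            (2 * ((N : ℝ) * (2 * (N : ℝ) - 4 / N) / ((2 * (N : ℝ) - 4 / N) ^ 2 - 4)) *
                (matrixOpNorm B + (matrixOpNorm B ^ 2 / 2 + matrixOpNorm B * Real.sqrt (matrixOpNorm B ^ 2 / 4 + 1 / (N : ℝ) ^ 2)))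
              + 2 * (2 * (N : ℝ) / ((2 * (N : ℝ) - 4 / N) ^ 2 - 4)) * N *
                ((matrixOpNorm B ^ 2 / 2 + matrixOpNorm B * Real.sqrt (matrixOpNorm B ^ 2 / 4 + 1 / (N : ℝ) ^ 2))
                  + matrixOpNorm B * (matrixOpNorm B / 2 + Real.sqrt (matrixOpNorm B ^ 2 / 4 + 1 / (N : ℝ) ^ 2)) ^ 2))) / 2)
          + (N : ℝ) ^ 2 / (4 * ((N : ℝ) ^ 2 - 4)) * (2 * matrixOpNorm B * frobNorm Δ))
        + ((N : ℝ) / (2 * ((N : ℝ) ^ 2 - 4)) + 1 / (4 * (N : ℝ))) * frobNorm Δ *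
          Real.sqrt (∫ g, ‖((g : Matrix (Fin N) (Fin N) ℂ) * B).trace‖ ^ 2
            ∂(haarProbability (SUN N)).tilted (fun g => (N : ℝ) * ((g : Matrix (Fin N) (Fin N) ℂ) * B).trace.re))
        + ((N : ℝ) / (2 * ((N : ℝ) ^ 2 - 4)) + 1 / (4 * (N : ℝ))) * frobNorm B *
          Real.sqrt (∫ g, ‖((g : Matrix (Fin N) (Fin N) ℂ) * Δ).trace‖ ^ 2
            ∂(haarProbability (SUN N)).tilted (fun g => (N : ℝ) * ((g : Matrix (Fin N) (Fin N) ℂ) * B).trace.re)) :=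
  sqrt_integral_Gam_upsi_le_omega hN B Δ (abs_integral_reTrQuad_DD_le_omegaPlus hN B Δ)

end Summit.Ventures.YMGap.OneLinkEigen
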